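import Literature.AlgebraicTopology.SingularHomology.LocallyFlatPairMapModel
import Literature.AlgebraicTopology.SingularHomology.LocalisationInjective
import Literature.AlgebraicTopology.SingularHomology.LocalHomologyVanishing
import HarnessLib

/-!
# Boxes of a locally flat stratum of any codimension under maps of pairs: non-vanishing in the target, and the range of one box is everything

Sequel of `SingularHomology/LocallyFlatCriticalDegree` (`H_k(Y | S; R) = R · θ` for a closed,
preconnected `S ⊆ Y` straightened by charts `Y ⇀ F × K` of normal dimension `dim F ≥ k ≥ 2`) and of
`SingularHomology/LocallyFlatPairMapModel` / `…PairMapLine` (the codimension-`2` case `F = ℂ` of a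
pair map reading as a coordinate in one chart). This file supplies, for ARBITRARY normal dimension
`dim F = m + 2`, the local-to-global facts about boxes needed by the moving lemma at the level of
classes in codimension `≥ 2` (C. Voisin, *Hodge Theory and Complex Algebraic Geometry II* (2003),
§9.2.4, proof of Prop. 9.21 (i) and Lemma 9.22: the class of a cycle read near a point where a
finite projection is a local isomorphism; W. Fulton, *Intersection Theory* §19.1 eq. (3) and
Lemma 19.1.1: `H²ᶜ(X, X − V)` is free of rank one on the class of `V`), all for TOPOLOGICAL
straightenings and with no orientation (A. Hatcher, *Algebraic Topology* (2002), §2.1 Prop. 2.19,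
Thm. 2.20, §2.2 p. 152, §3.3 p. 231 and proof of Thm. 3.35):

* `exists_homeomorph_ball_prod_of`, `bijective_map_fst_ball_of`,
  `nonempty_localHomology_zero_iso_of_finrank`, `exists_map_fst_ball_ne_zero_of_finrank` — the model
  computations of `LocallyFlatPairMapModel` with `ℂ` replaced by a real normed space `F` of
  dimension `m + 2`: the first coordinate `(B((0,y₀),r), B ∖ L) → (F, F ∖ 0)` induces bijections
  on relative homology and `H_{m+2}(F | 0; R) ≅ R`;
* `injective_map_of_isOpenEmbedding_of` — an open embedding `j : F → P` induces injections
  `H_n(F | 0) → H_n(P | j 0)` (excision);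
* `exists_map_box_ne_zero_of_eq_fst` — **if a map `Φ : Y → P` reads `Φ = j ((e₀ ·).1)` in a
  straightening chart `e₀` of `S` (`j` an open embedding of `F`, `j 0 = p₀`), a box of `e₀` carries
  a class with non-zero image under `Φ|_{box} : (box, box ∖ S) → (P, P ∖ p₀)`** (the target
  stratum is a POINT: no monodromy);
* `exists_toAmbient_box_ne_zero_of_pairMap` — **hence, if `Φ` maps `Y ∖ (S ∪ S'')` off `p₀` for a
  closed `S''` disjoint from the closed `S` and from the box, the class of the box is NON-ZERO in
  `H_{m+2}(Y | S)`**: its image in `H(Y | S ∪ S'')` maps to a non-zero class under `Φ_*`, its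
  restriction to `S''` factors through `H(box, box) = 0`, and a class of `H(Y | S ∪ S'')` dying at
  `S` and at `S''` dies (`localHomologyOfSet.eq_zero_of_restrictLocal_eq_zero_of_disjoint`, relative
  Mayer–Vietoris). This is how the moving lemma certifies that the Thom line of an algebraic
  subvariety `V ⊆ ℙⁿ` at a smooth point is non-zero — by the forms of a complete intersection
  `V ∪ V''` through `V`, read as a map to `ℙˡ` — without any positivity of intersections;
* `range_toAmbient_box_eq_top` — **for `S` closed, preconnected, straightened everywhere in normal
  dimension `≥ k ≥ 2` (`Y` second countable), the range of EVERY box of EVERY straightening chart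
  (normal dimension `≥ k`) in `H_k(Y | S; R)` is everything** (the step "all boxes have the range of
  `B₀`, and the boxes generate" of the proof of `exists_forall_mem_span_localHomologyOfSet_of_locallyFlat`,
  exported);
* `exists_toAmbient_box_ne_zero_of_ne_zero` — hence, over a field, as soon as `H_k(Y | S)` has a
  non-zero class, every such box has a generator with non-zero image and the box-to-ambient map
  is one-to-one.

Everything is proved; no definitions, no named facts.

## References

* [VoisinHodgeII2003] C. Voisin, Hodge Theory and Complex Algebraic Geometry II, CUP 2003, §9.2.4
  Prop. 9.21 (i) (proof) and Lemma 9.22.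
* [Fulton1998] W. Fulton, Intersection Theory, 2nd ed. 1998, §19.1 eq. (3) and Lemma 19.1.1.
* [HatcherAT2002] A. Hatcher, Algebraic Topology, CUP 2002, §2.1 Prop. 2.19, Thm. 2.20, §2.2 p. 152,
  §3.3 p. 231, Lemma 3.27 and proof of Thm. 3.35.
-/

noncomputable section

open CategoryTheory Limits Set TopologicalSpace Metric

universe u v

namespace Literature.AlgebraicTopology.SingularHomology

variable (R : Type v) [CommRing R] (M : Type v) [AddCommGroup M] [Module R M]

/-! ### The model ball in `F × K₀`, `F` a real normed space of dimension `m + 2` -/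

section Model

variable {F : Type} [NormedAddCommGroup F] {K₀ : Type} [NormedAddCommGroup K₀]

/-- The model ball `B((0, y₀), r) ⊆ F × K₀` is homeomorphic to `B_F(0, r) × B_{K₀}(y₀, r)`, the trace
of the flat piece `{p | p.1 = 0}` corresponding to `{0} × B_{K₀}(y₀, r)`, and the first coordinate
being preserved. [folklore] -/
theorem exists_homeomorph_ball_prod_of (y₀ : K₀) {r : ℝ} (hr : 0 < r) :
    ∃ η : ↥(ball ((0 : F), y₀) r) ≃ₜ ↥(ball (0 : F) r) × ↥(ball y₀ r),
      (∀ p, ((η p).1 : F) = p.1.1) ∧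
        η ⁻¹' (({⟨0, mem_ball_self hr⟩} : Set ↥(ball (0 : F) r)) ×ˢ (univ : Set ↥(ball y₀ r)))ᶜ =
          (Subtype.val ⁻¹' {p : F × K₀ | p.1 = 0} : Set ↥(ball ((0 : F), y₀) r))ᶜ := by
  have hmem : ∀ p : ↥(ball ((0 : F), y₀) r), p.1.1 ∈ ball (0 : F) r ∧ p.1.2 ∈ ball y₀ r := fun p ↦ by
    have h : p.1 ∈ ball (0 : F) r ×ˢ ball y₀ r := by
      rw [ball_prod_same]
      exact p.2
    exact ⟨h.1, h.2⟩
  have hmem' : ∀ q : ↥(ball (0 : F) r) × ↥(ball y₀ r), ((q.1 : F), (q.2 : K₀)) ∈ ball ((0 : F), y₀) r :=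
    fun q ↦ by rw [← ball_prod_same]; exact ⟨q.1.2, q.2.2⟩
  refine ⟨{ toFun := fun p ↦ (⟨p.1.1, (hmem p).1⟩, ⟨p.1.2, (hmem p).2⟩)
            invFun := fun q ↦ ⟨((q.1 : F), (q.2 : K₀)), hmem' q⟩
            left_inv := fun p ↦ rfl
            right_inv := fun q ↦ rfl
            continuous_toFun := by fun_prop
            continuous_invFun := by fun_prop }, fun p ↦ rfl, ?_⟩
  ext p
  simp only [mem_preimage, mem_compl_iff, mem_prod, mem_singleton_iff, mem_univ, and_true,
    mem_setOf_eq]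
  exact not_congr ⟨fun h ↦ congrArg Subtype.val h, fun h ↦ Subtype.ext h⟩

variable [NormedSpace ℝ K₀]

/-- **The first coordinate `(B((0,y₀),r), B ∖ L) → (F, F ∖ 0)` induces bijections on relative
homology** (product with a contractible ball, `localHomologyOfSet.isIso_map_fst_prod`, and excision
`H(B_F(0,r) | 0) ≅ H(F | 0)`). [cite: HatcherAT2002, §2.1 Prop. 2.19 and Thm. 2.20] -/
theorem bijective_map_fst_ball_of (y₀ : K₀) {r : ℝ} (hr : 0 < r)
    (hpr : MapsTo (fun p : ↥(ball ((0 : F), y₀) r) ↦ p.1.1)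
      (Subtype.val ⁻¹' {p : F × K₀ | p.1 = 0} : Set ↥(ball ((0 : F), y₀) r))ᶜ ({0}ᶜ : Set F)) (n : ℕ) :
    Function.Bijective (relativeSingularHomology.map R M
      (⟨fun p : ↥(ball ((0 : F), y₀) r) ↦ p.1.1, by fun_prop⟩ : C(↥(ball ((0 : F), y₀) r), F)) hpr n) := by
  obtain ⟨η, hη, hηpre⟩ := exists_homeomorph_ball_prod_of (F := F) (K₀ := K₀) y₀ hr
  haveI : ContractibleSpace ↥(ball y₀ r) := (convex_ball y₀ r).contractibleSpace ⟨y₀, mem_ball_self hr⟩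
  have h0 : (0 : F) ∈ ball (0 : F) r := mem_ball_self hr
  have hη' : MapsTo (η : C(↥(ball ((0 : F), y₀) r), ↥(ball (0 : F) r) × ↥(ball y₀ r)))
      (Subtype.val ⁻¹' {p : F × K₀ | p.1 = 0} : Set ↥(ball ((0 : F), y₀) r))ᶜ
      (({⟨0, h0⟩} : Set ↥(ball (0 : F) r)) ×ˢ (univ : Set ↥(ball y₀ r)))ᶜ := by
    intro p hp
    rw [← hηpre] at hp
    exact hp
  have h₁ := relativeSingularHomology.bijective_map_homeomorph R M η hηpre hη' n
  haveI := localHomologyOfSet.isIso_map_fst_prod R M (B := ↥(ball y₀ r))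
    ({⟨0, h0⟩} : Set ↥(ball (0 : F) r)) n
  haveI i₁ : IsIso (relativeSingularHomology.map R M _ hη' n) :=
    (LinearEquiv.ofBijective _ h₁).toModuleIso.isIso_hom
  haveI i₃ := localHomology.isIso_map_subsetIncl_of_isOpen R M (isOpen_ball : IsOpen (ball (0 : F) r)) h0 n
  have hfst := mapsTo_fst_compl_prod (B := ↥(ball y₀ r)) ({⟨0, h0⟩} : Set ↥(ball (0 : F) r))
  have hincl := localHomology.mapsTo_subsetIncl_compl (X := F) h0
  have key := LCube.relMap_congr R M
    (f := (⟨fun p : ↥(ball ((0 : F), y₀) r) ↦ p.1.1, by fun_prop⟩ : C(↥(ball ((0 : F), y₀) r), F)))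
    (g := ((subsetIncl (ball (0 : F) r)).comp
      (ContinuousMap.fst : C(↥(ball (0 : F) r) × ↥(ball y₀ r), ↥(ball (0 : F) r)))).comp
      (η : C(↥(ball ((0 : F), y₀) r), ↥(ball (0 : F) r) × ↥(ball y₀ r))))
    (ContinuousMap.ext fun p ↦ (hη p).symm) hpr ((hincl.comp hfst).comp hη') n
  rw [key, relativeSingularHomology.map_comp R M _ _ hη' (hincl.comp hfst) n,
    relativeSingularHomology.map_comp R M _ _ hfst hincl n]
  exact ConcreteCategory.bijective_of_isIso (_ ≫ _ ≫ _)

/-- `H_{m+2}(F | 0; M) ≅ M` for a real normed space `F` of dimension `m + 2` (Hatcher 2002, §3.3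
p. 231; the tree's `localHomologyRVecIso` transported along a linear homeomorphism `F ≅ ℝᵐ⁺²`).
[cite: HatcherAT2002, §3.3 p. 231] -/
theorem nonempty_localHomology_zero_iso_of_finrank [NormedSpace ℝ F] [FiniteDimensional ℝ F] {m : ℕ}
    (hF : Module.finrank ℝ F = m + 2) :
    Nonempty (localHomology R M F 0 (m + 2) ≅ ModuleCat.of R M) := by
  let L : F ≃L[ℝ] RVec (m + 2) := ContinuousLinearEquiv.ofFinrankEq (by simp [hF])
  exact ⟨localHomology.mapIso R M L.toHomeomorph 0 (m + 2) ≪≫ localHomologyRVecIso R M m _⟩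

/-- **The model group has a class which is non-zero in `H_{m+2}(F | 0)`**: some class of
`H_{m+2}(B((0,y₀),r) | L; R)` has non-zero image under the first coordinate (`R ≠ 0`,
`dim F = m + 2`). [cite: HatcherAT2002, §3.3 p. 231] -/
theorem exists_map_fst_ball_ne_zero_of_finrank [Nontrivial R] [NormedSpace ℝ F] [FiniteDimensional ℝ F]
    {m : ℕ} (hF : Module.finrank ℝ F = m + 2) (y₀ : K₀) {r : ℝ} (hr : 0 < r)
    (hpr : MapsTo (fun p : ↥(ball ((0 : F), y₀) r) ↦ p.1.1)
      (Subtype.val ⁻¹' {p : F × K₀ | p.1 = 0} : Set ↥(ball ((0 : F), y₀) r))ᶜ ({0}ᶜ : Set F)) :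
    ∃ x : localHomologyOfSet R R ↥(ball ((0 : F), y₀) r) (Subtype.val ⁻¹' {p : F × K₀ | p.1 = 0}) (m + 2),
      relativeSingularHomology.map R R
        (⟨fun p : ↥(ball ((0 : F), y₀) r) ↦ p.1.1, by fun_prop⟩ : C(↥(ball ((0 : F), y₀) r), F)) hpr
          (m + 2) x ≠ 0 := by
  obtain ⟨e⟩ := nonempty_localHomology_zero_iso_of_finrank R R hF
  have hne : (e.inv (1 : R)) ≠ 0 := by
    intro h
    have := congrArg e.hom h
    rw [← ModuleCat.comp_apply, e.inv_hom_id, ModuleCat.id_apply, map_zero] at this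
    exact one_ne_zero this
  obtain ⟨x, hx⟩ := (bijective_map_fst_ball_of R R y₀ hr hpr (m + 2)).2 (e.inv 1)
  exact ⟨x, by rw [hx]; exact hne⟩

end Model

/-! ### A box of a chart in which `Φ` is the first coordinate maps non-trivially to the target point -/

section PairMapChart

variable {Y : Type} [TopologicalSpace Y] {S : Set Y}
variable {P : Type} [TopologicalSpace P] [T1Space P]
variable {F : Type} [NormedAddCommGroup F] {K₀ : Type} [NormedAddCommGroup K₀] [NormedSpace ℝ K₀]

omit [NormedSpace ℝ K₀] in
/-- **An open embedding `j : F → P` induces injections `H_n(F | 0) → H_n(P | j 0)`** (the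
homeomorphism onto the open image, then excision; Hatcher 2002, Thm. 2.20). [cite: HatcherAT2002, Thm. 2.20] -/
theorem injective_map_of_isOpenEmbedding_of {j : F → P} (hj : Topology.IsOpenEmbedding j) {p₀ : P}
    (hj0 : j 0 = p₀) (hjm : MapsTo (⟨j, hj.continuous⟩ : C(F, P)) ({0}ᶜ : Set F) ({p₀}ᶜ : Set P))
    (n : ℕ) : Function.Injective (relativeSingularHomology.map R M (⟨j, hj.continuous⟩ : C(F, P)) hjm n) := by
  have hp₀ : p₀ ∈ range j := ⟨0, hj0⟩
  let j' : F ≃ₜ ↥(range j) := hj.isEmbedding.toHomeomorph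
  have hj' : ∀ z, ((j' z : ↥(range j)) : P) = j z := fun _ ↦ rfl
  have hpre : j' ⁻¹' ({⟨p₀, hp₀⟩}ᶜ : Set ↥(range j)) = ({0}ᶜ : Set F) := by
    ext z
    simp only [mem_preimage, mem_compl_iff, mem_singleton_iff]
    refine not_congr ⟨fun h ↦ hj.injective ?_, fun h ↦ Subtype.ext ?_⟩
    · rw [hj0, ← hj' z, h]
    · rw [hj' z, h, hj0]
  have hj'm : MapsTo (j' : C(F, ↥(range j))) ({0}ᶜ : Set F) ({⟨p₀, hp₀⟩}ᶜ : Set ↥(range j)) := by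
    intro z hz
    rw [← hpre] at hz
    exact hz
  have h₁ := relativeSingularHomology.bijective_map_homeomorph R M j' hpre hj'm n
  haveI : IsIso (relativeSingularHomology.map R M _ hj'm n) :=
    (LinearEquiv.ofBijective _ h₁).toModuleIso.isIso_hom
  have hincl := localHomology.mapsTo_subsetIncl_compl (X := P) hp₀
  haveI := localHomology.isIso_map_subsetIncl_of_isOpen R M hj.isOpen_range hp₀ n
  have key := LCube.relMap_congr R M (f := (⟨j, hj.continuous⟩ : C(F, P)))
    (g := (subsetIncl (range j)).comp (j' : C(F, ↥(range j))))
    (ContinuousMap.ext fun z ↦ (hj' z).symm) hjm (hincl.comp hj'm) n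
  rw [key, relativeSingularHomology.map_comp R M _ _ hj'm hincl n]
  exact (ConcreteCategory.bijective_of_isIso (_ ≫ _)).1

/-- **The local datum: a box of a chart in which `Φ` IS the first coordinate carries a class with
non-zero image in `H_{m+2}(P | p₀)`.** Let `e₀ : Y ⇀ F × K₀` straighten `S` (`dim F = m + 2`), let
`B₀ = e₀.source ∩ e₀⁻¹ B((0,y₀),r)` be a box (`B((0,y₀),r) ⊆ e₀.target`), and suppose that on
`e₀.source` the map `Φ : Y → P` reads `Φ z = j ((e₀ z).1)` with `j` an open embedding of `F`,
`j 0 = p₀`. Then some class of `H_{m+2}(B₀ | S; R)` (`R ≠ 0`) has non-zero image under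
`Φ|_{B₀} : (B₀, B₀ ∖ S) → (P, P ∖ p₀)`: through the chart this map is `j ∘ (first coordinate)`, a
composite of bijections and an injection (the codimension-`2`, rescaled version is
`exists_map_box_ne_zero`). [cite: HatcherAT2002, §2.1 Prop. 2.19 and Thm. 2.20] -/
theorem exists_map_box_ne_zero_of_eq_fst [Nontrivial R] [NormedSpace ℝ F] [FiniteDimensional ℝ F]
    {m : ℕ} (hF : Module.finrank ℝ F = m + 2) (e₀ : OpenPartialHomeomorph Y (F × K₀))
    (he₀S : ∀ z ∈ e₀.source, z ∈ S ↔ (e₀ z).1 = 0) (y₀ : K₀) {r : ℝ} (hr : 0 < r)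
    (hB : ball ((0 : F), y₀) r ⊆ e₀.target) (Φ : C(Y, P)) {p₀ : P}
    {j : F → P} (hj : Topology.IsOpenEmbedding j) (hj0 : j 0 = p₀)
    (hΦe : ∀ z ∈ e₀.source, Φ z = j (e₀ z).1)
    (hΦB : MapsTo (Φ.comp (subsetIncl (e₀.source ∩ e₀ ⁻¹' ball ((0 : F), y₀) r)))
      (Subtype.val ⁻¹' S : Set ↥(e₀.source ∩ e₀ ⁻¹' ball ((0 : F), y₀) r))ᶜ ({p₀}ᶜ : Set P)) :
    ∃ x : localHomologyOfSet R R ↥(e₀.source ∩ e₀ ⁻¹' ball ((0 : F), y₀) r) (Subtype.val ⁻¹' S) (m + 2),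
      relativeSingularHomology.map R R
        (Φ.comp (subsetIncl (e₀.source ∩ e₀ ⁻¹' ball ((0 : F), y₀) r))) hΦB (m + 2) x ≠ 0 := by
  -- the box homeomorphism
  set φ := e₀.homeomorphOfImageSubsetSource (s := e₀.source ∩ e₀ ⁻¹' ball ((0 : F), y₀) r)
    inter_subset_left (image_box_eq e₀ y₀ hB) with hφdef
  have hφ : ∀ z, ((φ z : ↥(ball ((0 : F), y₀) r)) : F × K₀) = e₀ z.1 := fun _ ↦ rfl
  have hφm := mapsTo_boxHomeomorph e₀ he₀S y₀ hB
  have hφbij := relativeSingularHomology.bijective_map_homeomorph R R φ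
    (preimage_boxHomeomorph e₀ he₀S y₀ hB) hφm (m + 2)
  have hpr : MapsTo (fun p : ↥(ball ((0 : F), y₀) r) ↦ p.1.1)
      (Subtype.val ⁻¹' {p : F × K₀ | p.1 = 0} : Set ↥(ball ((0 : F), y₀) r))ᶜ ({0}ᶜ : Set F) :=
    fun p hp h0 ↦ hp h0
  have hjm : MapsTo (⟨j, hj.continuous⟩ : C(F, P)) ({0}ᶜ : Set F) ({p₀}ᶜ : Set P) := by
    intro w hw h
    exact hw (hj.injective (by rw [hj0]; exact h))
  -- a class with non-zero first coordinate, pulled back to the box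
  obtain ⟨x₀, hx₀⟩ := exists_map_fst_ball_ne_zero_of_finrank R (K₀ := K₀) hF y₀ hr hpr
  obtain ⟨x, rfl⟩ := hφbij.2 x₀
  refine ⟨x, fun h0 ↦ hx₀ ?_⟩
  -- `Φ|_{B₀} = j ∘ fst ∘ φ`
  have key := LCube.relMap_congr R R
    (f := Φ.comp (subsetIncl (e₀.source ∩ e₀ ⁻¹' ball ((0 : F), y₀) r)))
    (g := ((⟨j, hj.continuous⟩ : C(F, P)).comp
      (⟨fun p : ↥(ball ((0 : F), y₀) r) ↦ p.1.1, by fun_prop⟩ : C(↥(ball ((0 : F), y₀) r), F))).comp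
      (φ : C(↥(e₀.source ∩ e₀ ⁻¹' ball ((0 : F), y₀) r), ↥(ball ((0 : F), y₀) r))))
    (ContinuousMap.ext fun z ↦ by
      change Φ z.1 = j ((φ z : ↥(ball ((0 : F), y₀) r)) : F × K₀).1
      rw [hφ z]
      exact hΦe z.1 z.2.1)
    hΦB ((hjm.comp hpr).comp hφm) (m + 2)
  rw [key, relativeSingularHomology.map_comp R R _ _ hφm (hjm.comp hpr) (m + 2),
    relativeSingularHomology.map_comp R R _ _ hpr hjm (m + 2), ModuleCat.comp_apply,
    ModuleCat.comp_apply] at h0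
  exact (injective_map_of_isOpenEmbedding_of R R hj hj0 hjm (m + 2)) (by rw [h0, map_zero])

/-- **The class of such a box is non-zero in `H_{m+2}(Y | S)`.** In the situation of
`exists_map_box_ne_zero_of_eq_fst`, suppose `S` is closed and `S'' ⊆ Y` is a closed set DISJOINT
from `S` and from the box `B₀`, and that `Φ` maps `Y ∖ (S ∪ S'')` into `P ∖ p₀` (in the algebraic
application `S ∪ S'' = V ∪ V''` is a complete intersection through `V = S` and `Φ` the map to `ℙˡ`
given by its `l + 1` forms). Then the box carries a class whose image in `H_{m+2}(Y | S; R)` is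
non-zero: its image `w` in `H_{m+2}(Y | S ∪ S'')` has `Φ_* w ≠ 0` (it is computed through the box,
`exists_map_box_ne_zero_of_eq_fst`), hence `w ≠ 0`; the restriction of `w` to `S''` factors through
`H(B₀, B₀) = 0`; and a class of `H(Y | S ∪ S'')` dying at `S` and at `S''` dies
(`localHomologyOfSet.eq_zero_of_restrictLocal_eq_zero_of_disjoint`, relative Mayer–Vietoris), so the
restriction of `w` to `S` — the image of the box class in `H_{m+2}(Y | S)` — is non-zero.
[cite: HatcherAT2002, §2.2 p. 152 and Thm. 2.20] [cite: Fulton1998, §19.1 Lemma 19.1.1 and eq. (3)] -/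
theorem exists_toAmbient_box_ne_zero_of_pairMap [Nontrivial R] [NormedSpace ℝ F] [FiniteDimensional ℝ F]
    {m : ℕ} (hF : Module.finrank ℝ F = m + 2) (hS : IsClosed S) {S'' : Set Y} (hS'' : IsClosed S'')
    (hdisj : Disjoint S S'') (e₀ : OpenPartialHomeomorph Y (F × K₀))
    (he₀S : ∀ z ∈ e₀.source, z ∈ S ↔ (e₀ z).1 = 0) (y₀ : K₀) {r : ℝ} (hr : 0 < r)
    (hB : ball ((0 : F), y₀) r ⊆ e₀.target)
    (hBS'' : Disjoint (e₀.source ∩ e₀ ⁻¹' ball ((0 : F), y₀) r) S'')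
    (Φ : C(Y, P)) {p₀ : P} (hΦ : MapsTo Φ (S ∪ S'')ᶜ ({p₀}ᶜ : Set P))
    {j : F → P} (hj : Topology.IsOpenEmbedding j) (hj0 : j 0 = p₀)
    (hΦe : ∀ z ∈ e₀.source, Φ z = j (e₀ z).1) :
    ∃ x : localHomologyOfSet R R ↥(e₀.source ∩ e₀ ⁻¹' ball ((0 : F), y₀) r) (Subtype.val ⁻¹' S) (m + 2),
      localHomologyOfSet.toAmbient R R S (e₀.source ∩ e₀ ⁻¹' ball ((0 : F), y₀) r) (m + 2) x ≠ 0 := by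
  set B₀ : Set Y := e₀.source ∩ e₀ ⁻¹' ball ((0 : F), y₀) r with hB₀
  -- the box as a map of pairs `(B₀, B₀ ∖ S) → (Y, Y ∖ (S ∪ S''))` and `→ (P, P ∖ p₀)`
  have hT : MapsTo (subsetIncl B₀) (Subtype.val ⁻¹' S : Set ↥B₀)ᶜ (S ∪ S'')ᶜ := by
    intro z hz hz'
    rcases hz' with h | h
    · exact hz h
    · exact (Set.disjoint_left.1 hBS'') z.2 h
  have hΦB : MapsTo (Φ.comp (subsetIncl B₀)) (Subtype.val ⁻¹' S : Set ↥B₀)ᶜ ({p₀}ᶜ : Set P) :=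
    fun z hz ↦ hΦ (hT hz)
  obtain ⟨x, hx⟩ := exists_map_box_ne_zero_of_eq_fst R hF e₀ he₀S y₀ hr hB Φ hj hj0 hΦe hΦB
  refine ⟨x, fun h0 ↦ hx ?_⟩
  -- the image `w` of `x` in `H(Y | S ∪ S'')`
  set w := relativeSingularHomology.map R R (subsetIncl B₀) hT (m + 2) x with hw
  -- `Φ_* w = (Φ|_{B₀})_* x`
  have hΦw : relativeSingularHomology.map R R Φ hΦ (m + 2) w =
      relativeSingularHomology.map R R (Φ.comp (subsetIncl B₀)) hΦB (m + 2) x := by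
    rw [hw, ← ModuleCat.comp_apply, ← relativeSingularHomology.map_comp]
  -- the restriction of `w` to `S` is the image of `x` in `H(Y | S)`, which is `0`
  have hwS : restrictLocal R R (Set.subset_union_left : S ⊆ S ∪ S'') (m + 2) w = 0 := by
    rw [hw, restrictLocal, ← ModuleCat.comp_apply, ← relativeSingularHomology.map_comp]
    have hcongr := LCube.relMap_congr R R (f := (ContinuousMap.id Y).comp (subsetIncl B₀))
      (g := subsetIncl B₀) (ContinuousMap.ext fun _ ↦ rfl)
      ((show MapsTo (ContinuousMap.id Y) (S ∪ S'')ᶜ Sᶜ from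
        fun _ hx ↦ Set.compl_subset_compl.2 Set.subset_union_left hx).comp hT)
      (localHomologyOfSet.mapsTo_val_compl B₀ S) (m + 2)
    rw [hcongr]
    exact h0
  -- the restriction of `w` to `S''` factors through `H(B₀, B₀) = 0`
  have hwS'' : restrictLocal R R (Set.subset_union_right : S'' ⊆ S ∪ S'') (m + 2) w = 0 := by
    have h₀ : MapsTo (ContinuousMap.id ↥B₀) (Subtype.val ⁻¹' S : Set ↥B₀)ᶜ Set.univ :=
      fun _ _ ↦ Set.mem_univ _
    have h₁ : MapsTo (subsetIncl B₀) (Set.univ : Set ↥B₀) (S''ᶜ : Set Y) :=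
      fun z _ hz ↦ (Set.disjoint_left.1 hBS'') z.2 hz
    have hfac : relativeSingularHomology.map R R (subsetIncl B₀) hT (m + 2) ≫
        restrictLocal R R (Set.subset_union_right : S'' ⊆ S ∪ S'') (m + 2) =
        relativeSingularHomology.map R R (ContinuousMap.id ↥B₀) h₀ (m + 2) ≫
          relativeSingularHomology.map R R (subsetIncl B₀) h₁ (m + 2) := by
      simp only [restrictLocal, ← relativeSingularHomology.map_comp]
      rfl
    rw [hw, ← ModuleCat.comp_apply, hfac,
      (isZero_relativeSingularHomology_univ R R (X := ↥B₀) (m + 2)).eq_of_tgt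
        (relativeSingularHomology.map R R (ContinuousMap.id ↥B₀) h₀ (m + 2)) 0, zero_comp]
    rfl
  -- hence `w = 0`, and `(Φ|_{B₀})_* x = Φ_* w = 0`
  have hw0 : w = 0 :=
    localHomologyOfSet.eq_zero_of_restrictLocal_eq_zero_of_disjoint R R hS hS'' hdisj (m + 2) hwS hwS''
  rw [← hΦw, hw0, map_zero]

end PairMapChart

/-! ### The range of every box is everything -/

section SameRange

variable {Y : Type} [TopologicalSpace Y] {S : Set Y}

/-- **For `S` closed, preconnected and straightened everywhere in normal dimension `≥ k ≥ 2` (`Y`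
second countable), the range in `H_k(Y | S; R)` of EVERY box of EVERY straightening chart of normal
dimension `≥ k` is the whole group.** This is the step "two boxes through a common point have the
same range (`range_toAmbient_box_eq_of_mem`), so by connectedness all boxes have the range of one
box `B₀`, and the boxes generate (`localHomologyOfSet.mem_iSup_range_toAmbient_of_cover`)" of the
proof of `exists_forall_mem_span_localHomologyOfSet_of_locallyFlat`, exported for consumers which
need that a GIVEN box (at a point where a pair map is read in coordinates) already spans — e.g.
the non-vanishing of the Thom line of an algebraic subvariety at one smooth point.
[cite: HatcherAT2002, §3.3 Lemma 3.27 and proof of Thm. 3.35] [cite: VoisinHodgeI2002, §11.1.2 proof of Lemma 11.13] -/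
theorem range_toAmbient_box_eq_top [SecondCountableTopology Y] (hS : IsClosed S)
    (hSc : IsPreconnected S) {k : ℕ} (hk2 : 2 ≤ k)
    (hflat : ∀ x ∈ S, ∃ (F : Type) (_ : NormedAddCommGroup F) (_ : NormedSpace ℝ F)
      (_ : FiniteDimensional ℝ F) (K : Type) (_ : NormedAddCommGroup K) (_ : NormedSpace ℝ K)
      (e : OpenPartialHomeomorph Y (F × K)),
      k ≤ Module.finrank ℝ F ∧ x ∈ e.source ∧ ∀ z ∈ e.source, z ∈ S ↔ (e z).1 = 0)
    {F K : Type} [NormedAddCommGroup F] [NormedSpace ℝ F] [FiniteDimensional ℝ F]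
    [NormedAddCommGroup K] [NormedSpace ℝ K] (e : OpenPartialHomeomorph Y (F × K))
    (hkF : k ≤ Module.finrank ℝ F) (heS : ∀ z ∈ e.source, z ∈ S ↔ (e z).1 = 0) (y : K) {r : ℝ}
    (hr : 0 < r) (hB : ball ((0 : F), y) r ⊆ e.target) :
    LinearMap.range (localHomologyOfSet.toAmbient R R S (e.source ∩ e ⁻¹' ball ((0 : F), y) r) k).hom = ⊤ := by
  classical
  -- the boxes of the straightening charts
  let IsBox : Set Y → Prop := fun B ↦ ∃ (F : Type) (_ : NormedAddCommGroup F) (_ : NormedSpace ℝ F)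
    (_ : FiniteDimensional ℝ F) (K : Type) (_ : NormedAddCommGroup K) (_ : NormedSpace ℝ K)
    (e : OpenPartialHomeomorph Y (F × K)) (y : K) (r : ℝ), k ≤ Module.finrank ℝ F ∧
      (∀ z ∈ e.source, z ∈ S ↔ (e z).1 = 0) ∧ 0 < r ∧ ball ((0 : F), y) r ⊆ e.target ∧
      B = e.source ∩ e ⁻¹' ball ((0 : F), y) r
  let rg : Set Y → Submodule R (localHomologyOfSet R R Y S k) := fun B ↦
    LinearMap.range (localHomologyOfSet.toAmbient R R S B k).hom
  -- our box is a box
  have hB₀ : IsBox (e.source ∩ e ⁻¹' ball ((0 : F), y) r) :=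
    ⟨F, inferInstance, inferInstance, inferInstance, K, inferInstance, inferInstance, e, y, r, hkF,
      heS, hr, hB, rfl⟩
  -- boxes are open and meet `S`
  have hBopen : ∀ B, IsBox B → IsOpen B := by
    rintro B ⟨F, _, _, _, K, _, _, e, y, r, -, -, -, -, rfl⟩
    exact e.isOpen_inter_preimage isOpen_ball
  -- every point of `S` has boxes inside any open neighbourhood
  have hBex : ∀ s ∈ S, ∀ O : Set Y, IsOpen O → s ∈ O → ∃ B, IsBox B ∧ s ∈ B ∧ B ⊆ O := by
    intro s hs O hO hsO
    obtain ⟨F, i₁, i₂, i₃, K, i₄, i₅, e, hkF, hse, heS⟩ := hflat s hs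
    obtain ⟨r, hr0, -, hBt, hBO, hsr⟩ := exists_box_subset e heS hs hse hO hsO zero_lt_one
    exact ⟨_, ⟨F, i₁, i₂, i₃, K, i₄, i₅, e, (e s).2, r, hkF, heS, hr0, hBt, rfl⟩, hsr, hBO⟩
  -- two boxes through a common point of `S` have the same range
  have hBeq : ∀ B B', IsBox B → IsBox B' → ∀ s ∈ S, s ∈ B → s ∈ B' → rg B = rg B' := by
    rintro B B' ⟨F, _, _, _, K, _, _, e, y, r, -, heS, hr, hB, rfl⟩
      ⟨F', _, _, _, K', _, _, e', y', r', -, heS', hr', hB', rfl⟩ s hs hsB hsB'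
    exact range_toAmbient_box_eq_of_mem R R e heS y hr hB e' heS' y' hr' hB' hs hsB hsB' hk2
  -- generation by the boxes
  have hgen : ∀ x : localHomologyOfSet R R Y S k, x ∈ ⨆ B ∈ {B | IsBox B}, rg B := by
    intro x
    refine localHomologyOfSet.mem_iSup_range_toAmbient_of_cover R R (S := S) hS k
      (fun W hW j hj ↦ isZero_localHomologyOfSet_of_locallyFlat R R hS k hflat hW (by omega) (by omega))
      (fun B hB ↦ hBopen B hB) (fun s hs ↦ ?_) x
    obtain ⟨B, hB, hsB, -⟩ := hBex s hs univ isOpen_univ (mem_univ s)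
    exact mem_sUnion_of_mem hsB hB
  -- the centre `s₀` of our box lies on `S`
  set B₀ : Set Y := e.source ∩ e ⁻¹' ball ((0 : F), y) r with hB₀def
  have hs₀ : e.symm ((0 : F), y) ∈ S :=
    (heS _ (e.map_target (hB (mem_ball_self hr)))).2 (by rw [e.right_inv (hB (mem_ball_self hr))])
  have hs₀B₀ : e.symm ((0 : F), y) ∈ B₀ :=
    ⟨e.map_target (hB (mem_ball_self hr)), by
      rw [mem_preimage, e.right_inv (hB (mem_ball_self hr))]; exact mem_ball_self hr⟩
  -- the set of points of `S` at which the boxes have the range of `B₀` is all of `S`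
  let A : Set Y := {s | s ∈ S ∧ ∃ B, IsBox B ∧ s ∈ B ∧ rg B = rg B₀}
  have hAS : S ⊆ A := by
    let U : Set Y := ⋃₀ {B | IsBox B ∧ rg B = rg B₀}
    let V : Set Y := ⋃₀ {B | IsBox B ∧ rg B ≠ rg B₀}
    have hU : IsOpen U := isOpen_sUnion fun B hB ↦ hBopen B hB.1
    have hV : IsOpen V := isOpen_sUnion fun B hB ↦ hBopen B hB.1
    have hcov : S ⊆ U ∪ V := by
      intro s hs
      obtain ⟨B, hB, hsB, -⟩ := hBex s hs univ isOpen_univ (mem_univ s)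
      by_cases h : rg B = rg B₀
      · exact Or.inl (mem_sUnion_of_mem hsB ⟨hB, h⟩)
      · exact Or.inr (mem_sUnion_of_mem hsB ⟨hB, h⟩)
    have hdisj : ¬ (S ∩ (U ∩ V)).Nonempty := by
      rintro ⟨s, hs, hsU, hsV⟩
      obtain ⟨B, ⟨hB, hBr⟩, hsB⟩ := mem_sUnion.1 hsU
      obtain ⟨B', ⟨hB', hB'r⟩, hsB'⟩ := mem_sUnion.1 hsV
      exact hB'r ((hBeq B' B hB' hB s hs hsB' hsB).trans hBr)
    have hSV : ¬ (S ∩ V).Nonempty := fun hne ↦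
      hdisj (hSc U V hU hV hcov ⟨_, hs₀, mem_sUnion_of_mem hs₀B₀ ⟨hB₀, rfl⟩⟩ hne)
    intro s hs
    rcases hcov hs with hsU | hsV
    · obtain ⟨B, ⟨hB, hBr⟩, hsB⟩ := mem_sUnion.1 hsU
      exact ⟨hs, B, hB, hsB, hBr⟩
    · exact absurd ⟨s, hs, hsV⟩ hSV
  -- hence every box has the range of `B₀`
  have hall : ∀ B, IsBox B → rg B = rg B₀ := by
    intro B hB
    obtain ⟨F', i₁, i₂, i₃, K', i₄, i₅, e', y', r', hkF', heS', hr', hBt', rfl⟩ := hB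
    have hc : e'.symm ((0 : F'), y') ∈ S :=
      (heS' _ (e'.map_target (hBt' (mem_ball_self hr')))).2
        (by rw [e'.right_inv (hBt' (mem_ball_self hr'))])
    have hcB : e'.symm ((0 : F'), y') ∈ e'.source ∩ e' ⁻¹' ball ((0 : F'), y') r' :=
      ⟨e'.map_target (hBt' (mem_ball_self hr')), by
        rw [mem_preimage, e'.right_inv (hBt' (mem_ball_self hr'))]; exact mem_ball_self hr'⟩
    obtain ⟨-, B', hB', hcB', hB'r⟩ := hAS hc
    rw [← hB'r]
    exact hBeq _ B' ⟨F', i₁, i₂, i₃, K', i₄, i₅, e', y', r', hkF', heS', hr', hBt', rfl⟩ hB' _ hc hcB hcB'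
  -- conclusion: the boxes generate and all have the range of `B₀`
  refine eq_top_iff.2 fun x _ ↦ ?_
  have hx := hgen x
  have hle : (⨆ B ∈ {B | IsBox B}, rg B) ≤ rg B₀ :=
    iSup₂_le fun B hB ↦ (hall B hB).le
  exact hle hx

/-- **If `H_k(Y | S; 𝕜)` has a non-zero class then the class of every box (normal dimension `≥ k`)
generates it and is non-zero** (over a field): the range of the box is everything
(`range_toAmbient_box_eq_top`) and is spanned by the image of one class
(`exists_range_toAmbient_box_eq_span`). [cite: HatcherAT2002, §3.3 proof of Thm. 3.35] -/
theorem exists_toAmbient_box_ne_zero_of_ne_zero {𝕜 : Type v} [Field 𝕜] [SecondCountableTopology Y]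
    (hS : IsClosed S) (hSc : IsPreconnected S) {k : ℕ} (hk2 : 2 ≤ k)
    (hflat : ∀ x ∈ S, ∃ (F : Type) (_ : NormedAddCommGroup F) (_ : NormedSpace ℝ F)
      (_ : FiniteDimensional ℝ F) (K : Type) (_ : NormedAddCommGroup K) (_ : NormedSpace ℝ K)
      (e : OpenPartialHomeomorph Y (F × K)),
      k ≤ Module.finrank ℝ F ∧ x ∈ e.source ∧ ∀ z ∈ e.source, z ∈ S ↔ (e z).1 = 0)
    {F K : Type} [NormedAddCommGroup F] [NormedSpace ℝ F] [FiniteDimensional ℝ F]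
    [NormedAddCommGroup K] [NormedSpace ℝ K] (e : OpenPartialHomeomorph Y (F × K))
    (hkF : k ≤ Module.finrank ℝ F) (heS : ∀ z ∈ e.source, z ∈ S ↔ (e z).1 = 0) (y : K) {r : ℝ}
    (hr : 0 < r) (hB : ball ((0 : F), y) r ⊆ e.target)
    (hne : ∃ t : localHomologyOfSet 𝕜 𝕜 Y S k, t ≠ 0) :
    ∃ x₀ : localHomologyOfSet 𝕜 𝕜 ↥(e.source ∩ e ⁻¹' ball ((0 : F), y) r) (Subtype.val ⁻¹' S) k,
      (∀ x, x ∈ Submodule.span 𝕜 ({x₀} : Set _)) ∧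
      localHomologyOfSet.toAmbient 𝕜 𝕜 S (e.source ∩ e ⁻¹' ball ((0 : F), y) r) k x₀ ≠ 0 ∧
      Function.Injective
        (localHomologyOfSet.toAmbient 𝕜 𝕜 S (e.source ∩ e ⁻¹' ball ((0 : F), y) r) k) := by
  obtain ⟨x₀, hx₀⟩ := exists_forall_mem_span_localHomologyOfSet_box 𝕜 e heS y hr hB hk2 hkF
  have htop := range_toAmbient_box_eq_top 𝕜 hS hSc hk2 hflat e hkF heS y hr hB
  set T := localHomologyOfSet.toAmbient 𝕜 𝕜 S (e.source ∩ e ⁻¹' ball ((0 : F), y) r) k with hT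
  -- the image of the generator is non-zero
  have hx₀ne : T x₀ ≠ 0 := by
    intro h0
    obtain ⟨t, ht⟩ := hne
    have htr : t ∈ LinearMap.range T.hom := by rw [htop]; exact Submodule.mem_top
    obtain ⟨x, hx⟩ := LinearMap.mem_range.1 htr
    obtain ⟨a, rfl⟩ := Submodule.mem_span_singleton.1 (hx₀ x)
    apply ht
    rw [← hx]
    change T (a • x₀) = 0
    rw [map_smul, h0, smul_zero]
  refine ⟨x₀, hx₀, hx₀ne, fun x x' hxx' ↦ ?_⟩
  obtain ⟨a, rfl⟩ := Submodule.mem_span_singleton.1 (hx₀ x)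
  obtain ⟨a', rfl⟩ := Submodule.mem_span_singleton.1 (hx₀ x')
  have h : (a - a') • T x₀ = 0 := by
    rw [sub_smul, ← map_smul, ← map_smul, sub_eq_zero]
    exact hxx'
  rcases smul_eq_zero.1 h with h | h
  · rw [sub_eq_zero.1 h]
  · exact absurd h hx₀ne

end SameRange

end Literature.AlgebraicTopology.SingularHomology

end
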